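import Mathlib
import Summits.Ventures.HodgeRepro2.T5HermitianIsotropicForm
import Summits.Ventures.HodgeRepro2.T5IntegralUnits
import Summits.Ventures.HodgeRepro2.T5HyperbolicComplement

/-!
# A unimodular hermitian lattice with a primitive isotropic vector has a basis with Gram matrix
`antidiag(1, u, 1)`, `u` a unit

Blind cell `pub-hodge-repro2`, seat p8 (gen 13), Tier-5 kernel support.  `T5HermitianIsotropicForm`
(T5-131) is the FIELD-level normal form `Pᴴ H P = antidiag(1, u, 1)`; the record's `K_v` is the
stabiliser of a SELF-DUAL lattice with such a basis, and this file is the INTEGRAL normal form (the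
case of Jacobowitz's classification used by the record): for `R` a DVR with fraction field `E`, an
involution preserving integrality with the TRACE DECOMPOSITION `htr` (every star-fixed integral
element is `c + star c`, `c` integral — the unramified case, printed; trivially when `2 ∈ R^×`),
`H` hermitian with integral entries and integral inverse (the Gram matrix of a self-dual lattice,
`T5UnitaryGroupIsometry`) and `e ∈ R³` isotropic and PRIMITIVE (one coordinate a unit), there is
`P ∈ GL₃(R)` with `Pᴴ H P = antidiag(1, u, 1)`, `u ∈ R^×`:

* `exists_isRUnit_vecMul` / `exists_integral_pairing_one` — `⟨e, ·⟩_H` takes a UNIT value on a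
  standard basis vector (`e` primitive, `H` unimodular; the unit-sum lemma of `T5IntegralUnits`);
* `exists_integral_hyperbolic_pair_of_trace` — the hyperbolic partner `f = w - c e ∈ R³` with
  `c + star c = ⟨w, w⟩` (`trace_of_two_inv`: `c = 2⁻¹ ⟨w, w⟩` when `2 ∈ R^×`);
* the projections `π(e_i)` of the standard basis onto `(e, f)^⊥` are `E`-multiples of one non-zero
  `x₀` (`T5HyperbolicComplement`: the kernel of the `2 × 3` system has dimension one), and one of
  them divides the others (`T5CartanUnitaryRankOne.exists_dvd_of_finite`);
* `exists_congruent_J3_integral_of_trace` — **`∃ P` with integral entries and integral inverse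
  (`P ∈ GL₃(R)`) and `u ∈ R^×` star-fixed with `Pᴴ H P = antidiag(1, u, 1)`**: the columns `e, x, f`
  generate `R³` (`P · C = 1`, `C` integral), and `u` is a unit since `det(Pᴴ H P) = -u`;
* `map_conj_hyperspecialSubgroup` — the conjugation `U(Pᴴ H P) ≃* U(H)` by `P ∈ GL_n(R)` maps
  `K_{Pᴴ H P}` onto `K_H`: **the stabiliser of the self-dual lattice in `U(H)` IS the `K_U` of the
  inert-place package** in the basis `e, x, f`.

`exists_primitive_isotropic` scales a non-zero isotropic vector of `E³` to a primitive integral one,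
so `exists_congruent_J3_integral_of_isotropic_of_trace` (and `…_of_isotropic`, the `2 ∈ R^×` form)
need only FIELD-level isotropy.  Stays a reading: that the record's hermitian space at an inert
place is isotropic (printed: a hermitian form in `≥ 3` variables over a non-archimedean local field
is) and that its lattice is self-dual (the record's choice of `L_v`); `htr` at an unramified place
is `T5UnramifiedTraceOne.trace_decomposition_of_unramified` (all residue characteristics).

README §8(d): uses an L-value-free non-vanishing device: NO.
-/

namespace Summit.Ventures.HodgeRepro2.T5HermitianIsotropicLattice

open IsLocalization Matrix T5UnitaryGroupIsometry T5HermitianIsotropicForm T5IntegralUnits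
  T5HyperbolicComplement

section Pairing

variable {R E : Type*} [CommRing R] [IsLocalRing R] [Field E] [StarRing E] [Algebra R E]
  [IsFractionRing R E]

/-- **A primitive integral vector pairs to a unit with some standard basis vector** when the
Gram matrix `H` is integral with integral inverse: `star e = (star e ᵥ* H) ᵥ* H⁻¹`, and a sum of
non-units of the local ring is a non-unit. -/
theorem exists_isRUnit_vecMul (hstar : ∀ x : E, IsInteger R x → IsInteger R (star x))
    {H : Matrix (Fin 3) (Fin 3) E} (hHint : ∀ i j, IsInteger R (H i j))
    (hHdet : IsUnit H.det) (hHinv : ∀ i j, IsInteger R (H⁻¹ i j)) {e : Fin 3 → E}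
    (he : ∀ i, IsInteger R (e i)) {i₀ : Fin 3} (hprim : IsRUnit R (e i₀)) :
    ∃ j, IsRUnit R ((star e ᵥ* H) j) := by
  by_contra hall
  -- `star e = (star e ᵥ* H) ᵥ* H⁻¹`
  have hrow : star e = (star e ᵥ* H) ᵥ* H⁻¹ := by
    rw [vecMul_vecMul, Matrix.mul_nonsing_inv H hHdet, vecMul_one]
  have hunit : IsRUnit R (star e i₀) := hprim.star hstar
  rw [hrow] at hunit
  change IsRUnit R (∑ l, (star e ᵥ* H) l * H⁻¹ l i₀) at hunit
  obtain ⟨l, hl⟩ := isRUnit_of_sum_three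
    (fun l => isInteger_mul (vecMul_mem_stdLattice hHint ((star_mem_stdLattice_iff hstar e).mpr he) l)
      (hHinv l i₀)) hunit
  exact hall ⟨l, isRUnit_of_mul_left
    (vecMul_mem_stdLattice hHint ((star_mem_stdLattice_iff hstar e).mpr he) l) (hHinv l i₀) hl⟩

/-- An integral vector `w` with `⟨e, w⟩_H = 1`. -/
theorem exists_integral_pairing_one (hstar : ∀ x : E, IsInteger R x → IsInteger R (star x))
    {H : Matrix (Fin 3) (Fin 3) E} (hHint : ∀ i j, IsInteger R (H i j))
    (hHdet : IsUnit H.det) (hHinv : ∀ i j, IsInteger R (H⁻¹ i j)) {e : Fin 3 → E}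
    (he : ∀ i, IsInteger R (e i)) {i₀ : Fin 3} (hprim : IsRUnit R (e i₀)) :
    ∃ w : Fin 3 → E, (∀ i, IsInteger R (w i)) ∧ sesqForm H e w = 1 := by
  obtain ⟨j, hj⟩ := exists_isRUnit_vecMul hstar hHint hHdet hHinv he hprim
  refine ⟨((star e ᵥ* H) j)⁻¹ • Pi.single j 1, ?_, ?_⟩
  · intro i
    rw [Pi.smul_apply, smul_eq_mul]
    exact isInteger_mul hj.2.2 (single_one_mem_stdLattice j i)
  · rw [sesqForm_smul_right, sesqForm, mulVec_single_one]
    have hcol : star e ⬝ᵥ H.col j = (star e ᵥ* H) j := rfl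
    rw [hcol]
    exact inv_mul_cancel₀ hj.2.1

omit [IsLocalRing R] [IsFractionRing R E] in
/-- The value `⟨v, w⟩_H` of integral vectors is integral (integral `H`, star preserving
integrality). -/
theorem isInteger_sesqForm (hstar : ∀ x : E, IsInteger R x → IsInteger R (star x))
    {H : Matrix (Fin 3) (Fin 3) E} (hHint : ∀ i j, IsInteger R (H i j)) {v w : Fin 3 → E}
    (hv : ∀ i, IsInteger R (v i)) (hw : ∀ i, IsInteger R (w i)) :
    IsInteger R (sesqForm H v w) := by
  rw [sesqForm, dotProduct_mulVec]
  exact isInteger_sum fun j _ => isInteger_mul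
    (vecMul_mem_stdLattice hHint ((star_mem_stdLattice_iff hstar v).mpr hv) j) (hw j)

/-- **The integral hyperbolic partner**: from `⟨e, w⟩ = 1`, `⟨e, e⟩ = 0` and a trace decomposition
`c + star c = ⟨w, w⟩` with `c` integral, `f = w - c • e ∈ R³` has `⟨e, f⟩ = 1` and `⟨f, f⟩ = 0`.  The
trace hypothesis `htr` holds for an unramified quadratic extension (the trace `𝒪_E → 𝒪_F` is onto —
printed) and trivially when `2 ∈ R^×` (`trace_of_two_inv`). -/
theorem exists_integral_hyperbolic_pair_of_trace
    (hstar : ∀ x : E, IsInteger R x → IsInteger R (star x))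
    (htr : ∀ y : E, IsInteger R y → star y = y → ∃ c : E, IsInteger R c ∧ c + star c = y)
    {H : Matrix (Fin 3) (Fin 3) E} (hH : H.IsHermitian) (hHint : ∀ i j, IsInteger R (H i j))
    (hHdet : IsUnit H.det) (hHinv : ∀ i j, IsInteger R (H⁻¹ i j)) {e : Fin 3 → E}
    (he : ∀ i, IsInteger R (e i)) {i₀ : Fin 3} (hprim : IsRUnit R (e i₀))
    (he0 : sesqForm H e e = 0) :
    ∃ f : Fin 3 → E, (∀ i, IsInteger R (f i)) ∧ sesqForm H e f = 1 ∧ sesqForm H f f = 0 := by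
  obtain ⟨w, hw, hew⟩ := exists_integral_pairing_one hstar hHint hHdet hHinv he hprim
  have hwe : sesqForm H w e = 1 := by
    rw [← star_sesqForm_of_isHermitian hH, hew, star_one]
  obtain ⟨c, hc, hcc⟩ := htr (sesqForm H w w) (isInteger_sesqForm hstar hHint hw hw)
    (star_sesqForm_self hH w)
  refine ⟨w - c • e, ?_, ?_, ?_⟩
  · intro i
    rw [Pi.sub_apply, Pi.smul_apply, smul_eq_mul]
    exact T5UnitaryThreeCorner.isInteger_sub (hw i) (isInteger_mul hc (he i))
  · rw [sesqForm_sub_right, sesqForm_smul_right, he0, mul_zero, sub_zero, hew]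
  · have hexp : sesqForm H (w - c • e) (w - c • e) =
        sesqForm H w w - c * sesqForm H w e - star c * sesqForm H e w +
          star c * (c * sesqForm H e e) := by
      rw [sesqForm_sub_right, sesqForm_sub_left, sesqForm_sub_left, sesqForm_smul_right,
        sesqForm_smul_right, sesqForm_smul_left, sesqForm_smul_left]
      ring
    rw [hexp, he0, hwe, hew, mul_one, mul_one, mul_zero, mul_zero, add_zero, ← hcc]
    ring

omit [IsLocalRing R] [IsFractionRing R E] in
/-- When `2 ∈ R^×`, every star-fixed integral element is the trace of `2⁻¹ y`. -/
theorem trace_of_two_inv (h2 : IsInteger R (2 : E)⁻¹) (h2ne : (2 : E) ≠ 0) :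
    ∀ y : E, IsInteger R y → star y = y → ∃ c : E, IsInteger R c ∧ c + star c = y := by
  intro y hy hsy
  refine ⟨(2 : E)⁻¹ * y, isInteger_mul h2 hy, ?_⟩
  rw [star_mul', hsy, star_inv₀, star_ofNat, ← two_mul, ← mul_assoc, mul_inv_cancel₀ h2ne, one_mul]

end Pairing

section Main

variable {R E : Type*} [CommRing R] [IsDomain R] [IsDiscreteValuationRing R] [Field E] [StarRing E]
  [Algebra R E] [IsFractionRing R E]

omit [IsDomain R] [IsDiscreteValuationRing R] [StarRing E] [IsFractionRing R E] in
/-- The determinant of an integral `3 × 3` matrix is integral. -/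
theorem isInteger_det {M : Matrix (Fin 3) (Fin 3) E} (h : ∀ i j, IsInteger R (M i j)) :
    IsInteger R M.det := by
  rw [Matrix.det_fin_three]
  repeat' first
    | exact h _ _
    | apply isInteger_mul
    | apply isInteger_add
    | apply T5UnitaryThreeCorner.isInteger_sub

omit [IsDomain R] [IsDiscreteValuationRing R] [IsFractionRing R E] in
/-- The entries of an integral-coefficient combination of integral vectors are integral. -/
theorem isInteger_projPerp (hstar : ∀ x : E, IsInteger R x → IsInteger R (star x))
    {H : Matrix (Fin 3) (Fin 3) E} (hHint : ∀ i j, IsInteger R (H i j)) {e f v : Fin 3 → E}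
    (he : ∀ i, IsInteger R (e i)) (hf : ∀ i, IsInteger R (f i)) (hv : ∀ i, IsInteger R (v i))
    (i : Fin 3) : IsInteger R (projPerp H e f v i) := by
  rw [projPerp_apply, Pi.sub_apply, Pi.sub_apply, Pi.smul_apply, Pi.smul_apply, smul_eq_mul,
    smul_eq_mul]
  exact T5UnitaryThreeCorner.isInteger_sub
    (T5UnitaryThreeCorner.isInteger_sub (hv i)
      (isInteger_mul (isInteger_sesqForm hstar hHint hf hv) (he i)))
    (isInteger_mul (isInteger_sesqForm hstar hHint he hv) (hf i))

/-- **The integral normal form**: `R` a DVR with fraction field `E`, an involution preserving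
integrality and with the trace decomposition `htr` (unramified, or `2 ∈ R^×`), `H` hermitian with
integral entries and integral inverse (a self-dual lattice), `e ∈ R³` primitive and isotropic.
Then there is `P` with integral entries and unit determinant (`P ∈ GL₃(R)`) and a star-fixed unit
`u` with `Pᴴ H P = antidiag(1, u, 1)`. -/
theorem exists_congruent_J3_integral_of_trace
    (hstar : ∀ x : E, IsInteger R x → IsInteger R (star x))
    (htr : ∀ y : E, IsInteger R y → star y = y → ∃ c : E, IsInteger R c ∧ c + star c = y)
    {H : Matrix (Fin 3) (Fin 3) E}
    (hH : H.IsHermitian) (hHint : ∀ i j, IsInteger R (H i j)) (hHdet : IsUnit H.det)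
    (hHinv : ∀ i j, IsInteger R (H⁻¹ i j)) {e : Fin 3 → E} (he : ∀ i, IsInteger R (e i))
    {i₀ : Fin 3} (hprim : IsRUnit R (e i₀)) (he0 : sesqForm H e e = 0) :
    ∃ P : Matrix (Fin 3) (Fin 3) E, (∀ i j, IsInteger R (P i j)) ∧ IsRUnit R P.det ∧
      ∃ u : E, IsRUnit R u ∧ star u = u ∧ Pᴴ * H * P = T5HermitianThreeElements.J3 u := by
  obtain ⟨f, hf, hef, hff⟩ :=
    exists_integral_hyperbolic_pair_of_trace hstar htr hH hHint hHdet hHinv he hprim he0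
  have hfe : sesqForm H f e = 1 := by
    rw [← star_sesqForm_of_isHermitian hH, hef, star_one]
  -- a non-zero vector orthogonal to `e` and `f`, and the projections of the standard basis
  obtain ⟨x₀, hx₀, hex₀, hfx₀⟩ := exists_orthogonal_ne_zero H e f
  have hproj := fun v => sesqForm_projPerp he0 hef hfe hff (H := H) v
  have hb : ∀ j : Fin 3, ∃ c : E, c • x₀ = projPerp H e f (Pi.single j 1) := fun j =>
    exists_smul_eq_of_orthogonal he0 hef hfe hff hx₀ hex₀ hfx₀ (hproj _).1 (hproj _).2
  choose b hb using hb
  -- not all `b j` vanish: otherwise `x₀` would lie in the plane of `e, f`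
  have hbne : ∃ j, b j ≠ 0 := by
    by_contra hall
    have hall' : ∀ j, b j = 0 := fun j => by
      by_contra hj
      exact hall ⟨j, hj⟩
    apply hx₀
    have hπ : projPerp H e f x₀ = 0 := by
      have hx₀sum : x₀ = ∑ j, x₀ j • (Pi.single j 1 : Fin 3 → E) := by
        funext i
        simp [Finset.sum_apply, Pi.single_apply]
      rw [hx₀sum, map_sum]
      refine Finset.sum_eq_zero fun j _ => ?_
      rw [map_smul, ← hb j, hall' j, zero_smul, smul_zero]
    have := projPerp_apply H e f x₀
    rw [hπ, hfx₀, hex₀, zero_smul, zero_smul, sub_zero, sub_zero] at this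
    exact this.symm
  -- the projection of minimal valuation divides the others
  obtain ⟨i₁, hi₁, hdvd⟩ := T5CartanUnitaryRankOne.exists_dvd_of_finite (R := R) b hbne
  set x : Fin 3 → E := projPerp H e f (Pi.single i₁ 1) with hx
  have hxint : ∀ i, IsInteger R (x i) :=
    isInteger_projPerp hstar hHint he hf (single_one_mem_stdLattice i₁)
  have hex : sesqForm H e x = 0 := (hproj _).1
  have hfx : sesqForm H f x = 0 := (hproj _).2
  have hxe : sesqForm H x e = 0 := by rw [← star_sesqForm_of_isHermitian hH, hex, star_zero]
  have hxf : sesqForm H x f = 0 := by rw [← star_sesqForm_of_isHermitian hH, hfx, star_zero]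
  -- every projection is an integral multiple of `x`
  have hyj : ∀ j, projPerp H e f (Pi.single j 1) = (b j / b i₁) • x := by
    intro j
    rw [hx, ← hb j, ← hb i₁, smul_smul, div_mul_cancel₀ _ hi₁]
  -- the matrix `P = (e | x | f)` and the coefficient matrix `C` with `P * C = 1`
  set P : Matrix (Fin 3) (Fin 3) E := Matrix.of fun i j => ![e, x, f] j i with hP
  set C : Matrix (Fin 3) (Fin 3) E := Matrix.of fun i j =>
    ![sesqForm H f (Pi.single j 1), b j / b i₁, sesqForm H e (Pi.single j 1)] i with hC
  have hcol : P.col = ![e, x, f] := by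
    funext j i
    rfl
  have hPC : P * C = 1 := by
    ext i j
    have hdecomp : (Pi.single j 1 : Fin 3 → E) =
        sesqForm H f (Pi.single j 1) • e + (b j / b i₁) • x + sesqForm H e (Pi.single j 1) • f := by
      have := projPerp_apply H e f (Pi.single j 1)
      rw [hyj j] at this
      rw [← sub_eq_zero]
      rw [this]
      abel
    have := congrFun hdecomp i
    rw [Matrix.mul_apply, Fin.sum_univ_three, Matrix.one_apply]
    simp only [hP, hC, Matrix.of_apply, Matrix.cons_val_zero, Matrix.cons_val_one,
      Matrix.cons_val_two, Matrix.head_cons, Matrix.tail_cons]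
    rw [Pi.single_apply] at this
    simp only [Pi.add_apply, Pi.smul_apply, smul_eq_mul] at this
    by_cases hij : i = j
    · subst hij
      simp only [if_true] at this ⊢
      linear_combination -this
    · simp only [hij, if_false] at this
      rw [if_neg hij]
      linear_combination -this
  have hPint : ∀ i j, IsInteger R (P i j) := by
    intro i j
    simp only [hP, Matrix.of_apply]
    fin_cases j
    · exact he i
    · exact hxint i
    · exact hf i
  have hCint : ∀ i j, IsInteger R (C i j) := by
    intro i j
    simp only [hC, Matrix.of_apply]
    fin_cases i
    · exact isInteger_sesqForm hstar hHint hf (single_one_mem_stdLattice j)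
    · exact hdvd j
    · exact isInteger_sesqForm hstar hHint he (single_one_mem_stdLattice j)
  have hdetPC : P.det * C.det = 1 := by
    rw [← Matrix.det_mul, hPC, Matrix.det_one]
  have hdetP : IsRUnit R P.det := by
    refine ⟨isInteger_det hPint, left_ne_zero_of_mul_eq_one hdetPC, ?_⟩
    rw [eq_inv_of_mul_eq_one_right hdetPC |>.symm]
    exact isInteger_det hCint
  -- the Gram matrix
  set u : E := sesqForm H x x with hu
  have hGram : Pᴴ * H * P = T5HermitianThreeElements.J3 u := by
    ext i j
    rw [T5HermitianIsotropicForm.gram_apply, hcol, T5HermitianThreeElements.J3_eq]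
    fin_cases i <;> fin_cases j <;> simp [he0, hex, hef, hxe, hxf, hfe, hfx, hff, hu]
  refine ⟨P, hPint, hdetP, u, ?_, star_sesqForm_self hH x, hGram⟩
  -- `u` is a unit: `-u = det (Pᴴ H P)` is a product of units
  have hdetH : IsRUnit R H.det := by
    refine ⟨isInteger_det hHint, hHdet.ne_zero, ?_⟩
    have := isInteger_det hHinv
    rwa [Matrix.det_nonsing_inv, Ring.inverse_eq_inv] at this
  have hdet : (T5HermitianThreeElements.J3 u).det = star P.det * H.det * P.det := by
    rw [← hGram, Matrix.det_mul, Matrix.det_mul, Matrix.det_conjTranspose]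
  rw [det_J3] at hdet
  have hstarP : IsRUnit R (star P.det) := hdetP.star hstar
  refine ⟨?_, ?_, ?_⟩
  · rw [hu]
    exact isInteger_sesqForm hstar hHint hxint hxint
  · intro hu0
    rw [hu0, neg_zero] at hdet
    exact (mul_ne_zero (mul_ne_zero hstarP.2.1 hdetH.2.1) hdetP.2.1) hdet.symm
  · have : u = -(star P.det * H.det * P.det) := by rw [← hdet, neg_neg]
    rw [this, inv_neg, mul_inv, mul_inv]
    exact T5UnitaryThreeCorner.isInteger_neg
      (isInteger_mul (isInteger_mul hstarP.2.2 hdetH.2.2) hdetP.2.2)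

/-- **A non-zero isotropic vector can be scaled to a primitive integral one**: divide by a
coordinate of minimal valuation (`T5CartanUnitaryRankOne.exists_dvd_of_finite`). -/
theorem exists_primitive_isotropic {H : Matrix (Fin 3) (Fin 3) E} {v : Fin 3 → E} (hv : v ≠ 0)
    (hv0 : sesqForm H v v = 0) :
    ∃ e : Fin 3 → E, (∀ i, IsInteger R (e i)) ∧ (∃ i₀, IsRUnit R (e i₀)) ∧ sesqForm H e e = 0 := by
  have hne : ∃ i, v i ≠ 0 := by
    by_contra hall
    exact hv (funext fun i => by
      by_contra hi
      exact hall ⟨i, hi⟩)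
  obtain ⟨i, hi, hdvd⟩ := T5CartanUnitaryRankOne.exists_dvd_of_finite (R := R) v hne
  refine ⟨(v i)⁻¹ • v, fun j => ?_, ⟨i, ?_⟩, ?_⟩
  · rw [Pi.smul_apply, smul_eq_mul, ← div_eq_inv_mul]
    exact hdvd j
  · rw [Pi.smul_apply, smul_eq_mul, inv_mul_cancel₀ hi]
    exact ⟨isInteger_one, one_ne_zero, by rw [inv_one]; exact isInteger_one⟩
  · rw [sesqForm_smul_left, sesqForm_smul_right, hv0, mul_zero, mul_zero]

/-- **The integral normal form from field-level isotropy**: `R` a DVR, `2 ∈ R^×`, `H` hermitian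
with integral entries and integral inverse, and `⟨·,·⟩_H` ISOTROPIC (some `v ≠ 0` with
`⟨v, v⟩_H = 0` — the printed input at an inert place).  Then `Pᴴ H P = antidiag(1, u, 1)` for some
`P ∈ GL₃(R)` and `u ∈ R^×`. -/
theorem exists_congruent_J3_integral_of_isotropic_of_trace
    (hstar : ∀ x : E, IsInteger R x → IsInteger R (star x))
    (htr : ∀ y : E, IsInteger R y → star y = y → ∃ c : E, IsInteger R c ∧ c + star c = y)
    {H : Matrix (Fin 3) (Fin 3) E} (hH : H.IsHermitian) (hHint : ∀ i j, IsInteger R (H i j))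
    (hHdet : IsUnit H.det) (hHinv : ∀ i j, IsInteger R (H⁻¹ i j)) {v : Fin 3 → E} (hv : v ≠ 0)
    (hv0 : sesqForm H v v = 0) :
    ∃ P : Matrix (Fin 3) (Fin 3) E, (∀ i j, IsInteger R (P i j)) ∧ IsRUnit R P.det ∧
      ∃ u : E, IsRUnit R u ∧ star u = u ∧ Pᴴ * H * P = T5HermitianThreeElements.J3 u := by
  obtain ⟨e, he, ⟨i₀, hprim⟩, he0⟩ := exists_primitive_isotropic (R := R) hv hv0
  exact exists_congruent_J3_integral_of_trace hstar htr hH hHint hHdet hHinv he hprim he0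

/-- The same with `2 ∈ R^×` in place of the trace decomposition (the odd residue characteristic). -/
theorem exists_congruent_J3_integral_of_isotropic
    (hstar : ∀ x : E, IsInteger R x → IsInteger R (star x)) (h2 : IsInteger R (2 : E)⁻¹)
    (h2ne : (2 : E) ≠ 0) {H : Matrix (Fin 3) (Fin 3) E} (hH : H.IsHermitian)
    (hHint : ∀ i j, IsInteger R (H i j)) (hHdet : IsUnit H.det)
    (hHinv : ∀ i j, IsInteger R (H⁻¹ i j)) {v : Fin 3 → E} (hv : v ≠ 0)
    (hv0 : sesqForm H v v = 0) :
    ∃ P : Matrix (Fin 3) (Fin 3) E, (∀ i j, IsInteger R (P i j)) ∧ IsRUnit R P.det ∧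
      ∃ u : E, IsRUnit R u ∧ star u = u ∧ Pᴴ * H * P = T5HermitianThreeElements.J3 u :=
  exists_congruent_J3_integral_of_isotropic_of_trace hstar (trace_of_two_inv h2 h2ne) hH hHint
    hHdet hHinv hv hv0

end Main

section Transport

variable {R E : Type*} [CommRing R] [Field E] [StarRing E] [Algebra R E] {ι : Type*} [Fintype ι]
  [DecidableEq ι]

omit [StarRing E] in
/-- Conjugation by `P ∈ GL_n(R)` preserves the image of `GL_n(R)`. -/
theorem conj_mem_range_iff (P g : GL ι E)
    (hP : P ∈ (Matrix.GeneralLinearGroup.map (algebraMap R E)).range) :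
    P * g * P⁻¹ ∈ (Matrix.GeneralLinearGroup.map (algebraMap R E)).range ↔
      g ∈ (Matrix.GeneralLinearGroup.map (algebraMap R E)).range := by
  constructor
  · intro h
    have := Subgroup.mul_mem _ (Subgroup.mul_mem _ (Subgroup.inv_mem _ hP) h) hP
    simpa [mul_assoc] using this
  · intro h
    exact Subgroup.mul_mem _ (Subgroup.mul_mem _ hP h) (Subgroup.inv_mem _ hP)

/-- The conjugation isomorphism `U(Pᴴ H P) ≃* U(H)` on elements: `g ↦ P g P⁻¹`. -/
theorem coe_formUnitaryGroupMulEquiv_conj (H : Matrix ι ι E) (P : GL ι E)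
    (g : T5UnitaryGroupForm.formUnitaryGroup ((P : Matrix ι ι E)ᴴ * H * (P : Matrix ι ι E))) :
    ((formUnitaryGroupMulEquiv_conj H P g : T5UnitaryGroupForm.formUnitaryGroup H) : GL ι E) =
      P * (g : GL ι E) * P⁻¹ :=
  rfl

/-- **The hyperspecial subgroup is transported by an integral base change**: for `P ∈ GL_n(R)`,
the conjugation isomorphism `U(Pᴴ H P) ≃* U(H)` maps `K_{Pᴴ H P}` onto `K_H` — with
`exists_congruent_J3_integral_of_trace`, the record's `K_v` (the stabiliser of the self-dual lattice `R³`
in `U(H)`) IS the `K_U` of the inert-place package for `antidiag(1, u, 1)`. -/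
theorem map_conj_hyperspecialSubgroup (H : Matrix ι ι E) (P : GL ι E)
    (hP : P ∈ (Matrix.GeneralLinearGroup.map (algebraMap R E)).range) :
    (T5UnitaryHeckeAdjoint.hyperspecialSubgroup R ((P : Matrix ι ι E)ᴴ * H * (P : Matrix ι ι E))).map
        (formUnitaryGroupMulEquiv_conj H P).toMonoidHom =
      T5UnitaryHeckeAdjoint.hyperspecialSubgroup R H := by
  ext g
  rw [Subgroup.mem_map]
  constructor
  · rintro ⟨k, hk, rfl⟩
    rw [Subgroup.mem_subgroupOf] at hk ⊢
    rw [MulEquiv.coe_toMonoidHom, coe_formUnitaryGroupMulEquiv_conj]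
    exact (conj_mem_range_iff P _ hP).mpr hk
  · intro hg
    refine ⟨(formUnitaryGroupMulEquiv_conj H P).symm g, ?_, MulEquiv.apply_symm_apply _ _⟩
    rw [Subgroup.mem_subgroupOf] at hg ⊢
    rw [← conj_mem_range_iff P _ hP, ← coe_formUnitaryGroupMulEquiv_conj,
      MulEquiv.apply_symm_apply]
    exact hg

end Transport

end Summit.Ventures.HodgeRepro2.T5HermitianIsotropicLattice
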